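import Literature.NumberTheory.EllipticCurves.NewformOpenImageLieProofs
import Literature.NumberTheory.EllipticCurves.NewformOpenImageLieAlgebraProofs
import HarnessLib

/-!
# Open image, V: the `ℓ`-adic Lie-algebra engine (proofs file)

Sibling proofs file of `NewformOpenImage.lean` (theorems only, no definitions; the Lie lattices
`Λₛ(G) = {a | exp (ℓˢ a) ∈ G}` and `Λ∞(G) = closure (⋃_{s ≥ 3} Λₛ(G))` of
`NewformOpenImageLieProofs.lean` are written out as set-builder expressions).  This file
assembles the exponential (`NewformOpenImageExpProofs`), the Lie lattice
(`NewformOpenImageLieProofs`) and the `2 × 2` Lie-algebra computation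
(`NewformOpenImageLieAlgebraProofs`) into the engine of the open-image theorem
`momose_isOpen_range_galoisRep` (Ribet 1985, Introduction (1) and §3; Ribet 1977, Thm. (5.7),
after Serre, *Abelian ℓ-adic representations*, Ch. IV, "`𝔤_ℓ = 𝔤𝔩₂`, hence `G_ℓ` open"):

* `OpenImage.E_F_H_mem_latticeInfty_of_forall_exists_not_eigenline` — if `G ∩ Γ(ℓ³)` has no
  invariant line over a field `E ⊇ ℚ_ℓ` containing the square roots of `ℚ_ℓ`, then
  `E, F, H ∈ Λ∞(G)` ("`𝔤 ⊇ 𝔰𝔩₂`"; else the `ℚ_ℓ`-span of `Λ∞(G)`, a Lie subalgebra of `𝔤𝔩₂`,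
  has an invariant line, hence so do `Λ₃(G)` and `G ∩ Γ(ℓ³)`).
* `OpenImage.exists_sl2_meets_of_E_F_H_mem_latticeInfty`,
  `OpenImage.exists_sl2_meets_of_forall_exists_not_eigenline` — **ENGINE, `SL₂` form**: then at
  some level `s ≥ 2` every class `1 + ℓˢ a (mod ℓ^{s+1})`, `ℓ ∣ tr a`, contains an element of `G`
  of determinant `1` (commutators `(1 + ℓᵃx, 1 + ℓᵇy) ≡ 1 + ℓ^{a+b}[x, y] (mod ℓ^{a+b+m})` of
  exponentials approximating `E, F, H`; `ℓ = 2`: `2ℓ^{2t}E = ℓ^{2t+1}E`; `ℓ` odd: powers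
  `(ℓ ± 1)/2`) — hypothesis (1) of `OpenImage.isOpen_range_of_sl2_meets_of_det`.
* `OpenImage.det_exp_eq_one_of_trace_eq_zero` — `det (exp A) = 1` for trace-free `A`
  (`−Aᵀ = J A J⁻¹`, so `det exp(−A) = det exp(A)`, and `det exp(A) ≡ 1 (mod ℓˢ)`).
* `OpenImage.mem_latticeInfty_of_trace_ne_zero`, `OpenImage.exists_meets_of_forall_mem_latticeInfty`,
  `OpenImage.exists_meets_of_forall_exists_not_eigenline_of_det_ne_one` — **ENGINE, `GL₂` form**:
  if moreover `G ∩ Γ(ℓ³)` contains an element of determinant `≠ 1` then `Λ∞(G) = M₂(ℤ_ℓ)`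
  (saturation) and `G` meets every class of `Γ(ℓˢ)/Γ(ℓ^{s+1})` at some level `s ≥ 2` — the
  hypothesis of `OpenImage.congruenceSubgroup_le_of_isClosed` / `isOpen_range_of_meets`, which
  give `Γ(ℓˢ) ≤ \bar G`, i.e. openness ("`𝔤_ℓ = 𝔤𝔩₂`").

What remains for `momose_isOpen_range_galoisRep_holds` (recorded, not claimed): for `ρ` attached
to a rational non-CM newform of weight `k ≥ 2` and `G = ι⁻¹(ρ(Γ_ℚ)) ≤ GL₂(ℤ_ℓ)`, hypothesis (1)
(no invariant line on `ρ⁻¹(Γ(ℓ³))` over `\bar ℚ_ℓ`: Ribet 1977, Thm. (2.3) = the named fact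
`Ribet1977.thm23_isIrreducible`, plus (4.3)–(4.4): Clifford, CM by the quadratic character of an
index-`2` stabiliser via Kronecker–Weber, finiteness of the projective image excluded by `k` even)
and hypothesis (2) (`det ρ(Frob_p) = p^{k−1} ≠ 1` on an open subgroup); then
`OpenImage.isOpen_range_of_meets`.

## References

* J.-P. Serre, *Abelian ℓ-adic representations and elliptic curves*, Benjamin 1968, Ch. IV
  (§2.2 Lie algebras of ℓ-adic Galois images; §3.4 Lemma 3, IV-23). [SerreAbelianLadic1968]
* K. A. Ribet, *Galois representations attached to eigenforms with Nebentypus*, LNM 601 (1977),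
  §4 and Thm. (5.7). [Ribet1977Nebentypus]
* K. A. Ribet, *On ℓ-adic representations attached to modular forms II*, Glasgow Math. J. 27
  (1985) 185–194, Introduction (1), §3 (p. 191). [Ribet1985]
-/

noncomputable section

open scoped MatrixGroups NNReal ENNReal Nat
open Matrix Filter Topology NormedSpace

namespace Literature.NumberTheory.EllipticCurves.ModularForms

namespace OpenImage

open Literature.GroupTheory.Index

variable {ℓ : ℕ} [Fact ℓ.Prime]

/-! ### Congruences: representatives, products, reduction of the level -/

/-- Changing the representative modulo `ℓᵐ`: if `ℓᵐ ∣ (a − b)` entrywise then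
`1 + ℓˢ a ≡ 1 + ℓˢ b (mod ℓ^{s+m})`. [folklore] -/
theorem map_one_add_smul_eq_of_pow_dvd_sub {s m : ℕ} {a b : Matrix (Fin 2) (Fin 2) ℤ_[ℓ]}
    (h : ∀ i j, (ℓ : ℤ_[ℓ]) ^ m ∣ (a - b) i j) :
    (1 + (ℓ : ℤ_[ℓ]) ^ s • a).map (PadicInt.toZModPow (s + m)) =
      (1 + (ℓ : ℤ_[ℓ]) ^ s • b).map (PadicInt.toZModPow (s + m)) := by
  rw [map_toZModPow_eq_iff]
  intro i j
  obtain ⟨c, hc⟩ := h i j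
  refine ⟨c, ?_⟩
  rw [Matrix.sub_apply] at hc
  simp only [Matrix.add_apply, Matrix.smul_apply, smul_eq_mul]
  rw [pow_add]
  linear_combination (ℓ : ℤ_[ℓ]) ^ s * hc

/-- Reduction of the level of a congruence. [folklore] -/
theorem map_toZModPow_eq_of_le_of_map_eq {N M : ℕ} (h : N ≤ M) {A B : Matrix (Fin 2) (Fin 2) ℤ_[ℓ]}
    (hAB : A.map (PadicInt.toZModPow M) = B.map (PadicInt.toZModPow M)) :
    A.map (PadicInt.toZModPow N) = B.map (PadicInt.toZModPow N) :=
  (map_toZModPow_eq_iff _ _ _).2 fun i j ↦ (pow_dvd_pow _ h).trans ((map_toZModPow_eq_iff _ _ _).1 hAB i j)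

/-- Brackets of congruent matrices are congruent: `x ≡ c`, `y ≡ d (mod ℓᵐ)` imply
`[x, y] ≡ [c, d] (mod ℓᵐ)`. [folklore] -/
theorem pow_dvd_bracket_sub_bracket {m : ℕ} {x y c d : Matrix (Fin 2) (Fin 2) ℤ_[ℓ]}
    (hx : ∀ i j, (ℓ : ℤ_[ℓ]) ^ m ∣ (x - c) i j) (hy : ∀ i j, (ℓ : ℤ_[ℓ]) ^ m ∣ (y - d) i j) :
    ∀ i j, (ℓ : ℤ_[ℓ]) ^ m ∣ ((x * y - y * x) - (c * d - d * c)) i j := by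
  have hx' : x.map (PadicInt.toZModPow m) = c.map (PadicInt.toZModPow m) := (map_toZModPow_eq_iff _ _ _).2 hx
  have hy' : y.map (PadicInt.toZModPow m) = d.map (PadicInt.toZModPow m) := (map_toZModPow_eq_iff _ _ _).2 hy
  obtain ⟨w, hw⟩ := exists_eq_add_smul_of_map_eq hx'
  obtain ⟨w', hw'⟩ := exists_eq_add_smul_of_map_eq hy'
  have he : (x * y - y * x) - (c * d - d * c) =
      (ℓ : ℤ_[ℓ]) ^ m • (c * w' + w * d - (d * w + w' * c) + (ℓ : ℤ_[ℓ]) ^ m • (w * w' - w' * w)) := by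
    rw [hw, hw']
    simp only [mul_add, add_mul, smul_mul_assoc, mul_smul_comm, smul_add, smul_sub, smul_smul]
    module
  intro i j
  rw [he, Matrix.smul_apply, smul_eq_mul]
  exact dvd_mul_right _ _

/-- **Commutators in `G` hitting a prescribed class.**  If `g₁ = 1 + ℓᵃ x`, `g₂ = 1 + ℓᵇ y` lie in
`G` and `[x, y] ≡ C (mod ℓᵐ)`, `m ≤ min(a, b)`, then the commutator `(g₁, g₂) ∈ G` has
determinant `1` and is `≡ 1 + ℓ^{a+b} C (mod ℓ^{a+b+m})`. [folklore] -/
theorem exists_det_one_map_eq_of_bracket {G : Subgroup (GL (Fin 2) ℤ_[ℓ])} {a b m : ℕ} (hma : m ≤ a) (hmb : m ≤ b)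
    {g₁ g₂ : GL (Fin 2) ℤ_[ℓ]} (hg₁ : g₁ ∈ G) (hg₂ : g₂ ∈ G) {x y C : Matrix (Fin 2) (Fin 2) ℤ_[ℓ]}
    (hx : (g₁ : Matrix (Fin 2) (Fin 2) ℤ_[ℓ]) = 1 + (ℓ : ℤ_[ℓ]) ^ a • x)
    (hy : (g₂ : Matrix (Fin 2) (Fin 2) ℤ_[ℓ]) = 1 + (ℓ : ℤ_[ℓ]) ^ b • y)
    (hC : ∀ i j, (ℓ : ℤ_[ℓ]) ^ m ∣ ((x * y - y * x) - C) i j) :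
    ∃ g ∈ G, (g : Matrix (Fin 2) (Fin 2) ℤ_[ℓ]).det = 1 ∧
      (g : Matrix (Fin 2) (Fin 2) ℤ_[ℓ]).map (PadicInt.toZModPow (a + b + m)) =
        (1 + (ℓ : ℤ_[ℓ]) ^ (a + b) • C).map (PadicInt.toZModPow (a + b + m)) := by
  refine ⟨g₁ * g₂ * g₁⁻¹ * g₂⁻¹, G.mul_mem (G.mul_mem (G.mul_mem hg₁ hg₂) (G.inv_mem hg₁)) (G.inv_mem hg₂),
    det_commutator_eq_one g₁ g₂, ?_⟩
  rw [map_commutator_eq_of_le hma hmb hx hy]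
  exact map_one_add_smul_eq_of_pow_dvd_sub hC

/-- **Exact first-order forms of lattice elements.**  For `u ∈ Λₜ(G)` (`t ≥ 3`) with `u ≡ c (mod ℓ²)`
the element `exp (ℓᵗ u) ∈ G` is `1 + ℓᵗ x` with `x ≡ c (mod ℓ²)`. [folklore] -/
theorem exists_eq_one_add_smul_of_mem_lattice {G : Subgroup (GL (Fin 2) ℤ_[ℓ])} {t : ℕ} (ht : 3 ≤ t)
    {u c : Matrix (Fin 2) (Fin 2) ℤ_[ℓ]} (hu : u ∈ {a : Matrix (Fin 2) (Fin 2) ℤ_[ℓ] | ∃ g ∈ G,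
          (g : Matrix (Fin 2) (Fin 2) ℤ_[ℓ]).map ((↑) : ℤ_[ℓ] → ℚ_[ℓ]) =
            NormedSpace.exp ((ℓ : ℚ_[ℓ]) ^ t • a.map ((↑) : ℤ_[ℓ] → ℚ_[ℓ]))}) (huc : ∀ i j, (ℓ : ℤ_[ℓ]) ^ 2 ∣ (u - c) i j) :
    ∃ g ∈ G, ∃ x : Matrix (Fin 2) (Fin 2) ℤ_[ℓ], (g : Matrix (Fin 2) (Fin 2) ℤ_[ℓ]) = 1 + (ℓ : ℤ_[ℓ]) ^ t • x ∧
      ∀ i j, (ℓ : ℤ_[ℓ]) ^ 2 ∣ (x - c) i j := by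
  obtain ⟨g, hg, hgu⟩ := hu
  obtain ⟨r, hr⟩ := exists_eq_one_add_smul_add_of_map_eq_exp ht hgu
  refine ⟨g, hg, u + (ℓ : ℤ_[ℓ]) ^ (t - 1) • r, ?_, fun i j ↦ ?_⟩
  · rw [hr, smul_add, smul_smul, ← pow_add, show t + (t - 1) = 2 * t - 1 by omega, add_assoc]
  · have e : (u + (ℓ : ℤ_[ℓ]) ^ (t - 1) • r - c) i j = (u - c) i j + (ℓ : ℤ_[ℓ]) ^ 2 * ((ℓ : ℤ_[ℓ]) ^ (t - 3) * r i j) := by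
      simp only [Matrix.sub_apply, Matrix.add_apply, Matrix.smul_apply, smul_eq_mul]
      rw [← mul_assoc, ← pow_add, show 2 + (t - 3) = t - 1 by omega]
      ring
    rw [e]
    exact (huc i j).add (dvd_mul_right _ _)

/-! ### The constant matrices `E, F, H` -/

/-- `[H, E] = 2E`. [folklore] -/
theorem bracket_H_E {R : Type*} [CommRing R] :
    (!![1, 0; 0, -1] : Matrix (Fin 2) (Fin 2) R) * !![0, 1; 0, 0] - !![0, 1; 0, 0] * !![1, 0; 0, -1] =
      (2 : R) • !![0, 1; 0, 0] := by
  ext i j; fin_cases i <;> fin_cases j <;> simp; norm_num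

/-- `[H, F] = −2F`. [folklore] -/
theorem bracket_H_F {R : Type*} [CommRing R] :
    (!![1, 0; 0, -1] : Matrix (Fin 2) (Fin 2) R) * !![0, 0; 1, 0] - !![0, 0; 1, 0] * !![1, 0; 0, -1] =
      (-2 : R) • !![0, 0; 1, 0] := by
  ext i j; fin_cases i <;> fin_cases j <;> simp; norm_num

/-- `[E, F] = H`. [folklore] -/
theorem bracket_E_F {R : Type*} [CommRing R] :
    (!![0, 1; 0, 0] : Matrix (Fin 2) (Fin 2) R) * !![0, 0; 1, 0] - !![0, 0; 1, 0] * !![0, 1; 0, 0] =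
      !![1, 0; 0, -1] := by
  ext i j; fin_cases i <;> fin_cases j <;> simp

/-- `ι(E) = E`, `ι(F) = F`, `ι(H) = H`. [folklore] -/
theorem map_coe_E_F_H :
    ((!![0, 1; 0, 0] : Matrix (Fin 2) (Fin 2) ℤ_[ℓ]).map ((↑) : ℤ_[ℓ] → ℚ_[ℓ]) = !![0, 1; 0, 0]) ∧
    ((!![0, 0; 1, 0] : Matrix (Fin 2) (Fin 2) ℤ_[ℓ]).map ((↑) : ℤ_[ℓ] → ℚ_[ℓ]) = !![0, 0; 1, 0]) ∧
    ((!![1, 0; 0, -1] : Matrix (Fin 2) (Fin 2) ℤ_[ℓ]).map ((↑) : ℤ_[ℓ] → ℚ_[ℓ]) = !![1, 0; 0, -1]) := by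
  refine ⟨?_, ?_, ?_⟩ <;> (ext i j; fin_cases i <;> fin_cases j <;> simp)

/-! ### From `E, F, H ∈ Λ∞(G)` to the classes of `𝔰𝔩₂` at one level -/

/-- Three elements of `⋃ₛ Λₛ(G)` lie in a common `Λₜ(G)`, `t ≥ 3`. [folklore] -/
theorem exists_mem_lattice_three {G : Subgroup (GL (Fin 2) ℤ_[ℓ])} {a b c : Matrix (Fin 2) (Fin 2) ℤ_[ℓ]}
    (ha : a ∈ ⋃ n : ℕ, {a : Matrix (Fin 2) (Fin 2) ℤ_[ℓ] | ∃ g ∈ G,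
          (g : Matrix (Fin 2) (Fin 2) ℤ_[ℓ]).map ((↑) : ℤ_[ℓ] → ℚ_[ℓ]) =
            NormedSpace.exp ((ℓ : ℚ_[ℓ]) ^ (n + 3) • a.map ((↑) : ℤ_[ℓ] → ℚ_[ℓ]))}) (hb : b ∈ ⋃ n : ℕ,
                {a : Matrix (Fin 2) (Fin 2) ℤ_[ℓ] | ∃ g ∈ G,
                      (g : Matrix (Fin 2) (Fin 2) ℤ_[ℓ]).map ((↑) : ℤ_[ℓ] → ℚ_[ℓ]) =
                        NormedSpace.exp ((ℓ : ℚ_[ℓ]) ^ (n + 3) • a.map ((↑) : ℤ_[ℓ] → ℚ_[ℓ]))}) (hc : c ∈ ⋃ n : ℕ,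
                            {a : Matrix (Fin 2) (Fin 2) ℤ_[ℓ] | ∃ g ∈ G,
                                  (g : Matrix (Fin 2) (Fin 2) ℤ_[ℓ]).map ((↑) : ℤ_[ℓ] → ℚ_[ℓ]) =
                                    NormedSpace.exp ((ℓ : ℚ_[ℓ]) ^ (n + 3) • a.map ((↑) : ℤ_[ℓ] → ℚ_[ℓ]))}) :
    ∃ t, 3 ≤ t ∧ a ∈ {a : Matrix (Fin 2) (Fin 2) ℤ_[ℓ] | ∃ g ∈ G,
          (g : Matrix (Fin 2) (Fin 2) ℤ_[ℓ]).map ((↑) : ℤ_[ℓ] → ℚ_[ℓ]) =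
            NormedSpace.exp ((ℓ : ℚ_[ℓ]) ^ t • a.map ((↑) : ℤ_[ℓ] → ℚ_[ℓ]))} ∧ b ∈
                {a : Matrix (Fin 2) (Fin 2) ℤ_[ℓ] | ∃ g ∈ G,
                      (g : Matrix (Fin 2) (Fin 2) ℤ_[ℓ]).map ((↑) : ℤ_[ℓ] → ℚ_[ℓ]) =
                        NormedSpace.exp ((ℓ : ℚ_[ℓ]) ^ t • a.map ((↑) : ℤ_[ℓ] → ℚ_[ℓ]))} ∧ c ∈
                            {a : Matrix (Fin 2) (Fin 2) ℤ_[ℓ] | ∃ g ∈ G,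
                                  (g : Matrix (Fin 2) (Fin 2) ℤ_[ℓ]).map ((↑) : ℤ_[ℓ] → ℚ_[ℓ]) =
                                    NormedSpace.exp ((ℓ : ℚ_[ℓ]) ^ t • a.map ((↑) : ℤ_[ℓ] → ℚ_[ℓ]))} := by
  obtain ⟨m, hm⟩ := Set.mem_iUnion.1 ha
  obtain ⟨n, hn⟩ := Set.mem_iUnion.1 hb
  obtain ⟨k, hk⟩ := Set.mem_iUnion.1 hc
  refine ⟨m + n + k + 3, by omega, ?_, ?_, ?_⟩
  · exact mem_lattice_of_le (by omega) (by omega) hm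
  · exact mem_lattice_of_le (by omega) (by omega) hn
  · exact mem_lattice_of_le (by omega) (by omega) hk

/-- **If `E, F, H ∈ Λ∞(G)` then `G` meets every class of `𝔰𝔩₂` at some level `s ≥ 2` with
elements of determinant `1`** (the hypothesis of `OpenImage.mem_of_isClosed_of_sl2_meets`):
approximate `E, F, H` modulo `ℓ²` inside one `Λₜ(G)`, exponentiate, and take commutators —
`(exp ℓᵗH, exp ℓᵗE) ≡ 1 + 2ℓ^{2t} E`, `(exp ℓᵗH, exp ℓᵗF) ≡ 1 − 2ℓ^{2t} F`,
`(exp ℓ^{t+1}E, exp ℓᵗF) ≡ 1 + ℓ^{2t+1} H` — which at level `2t + 1` give the classes of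
`E, F, H` (for `ℓ = 2` directly, for odd `ℓ` after raising to the power `(ℓ ± 1)/2`).
[folklore] -/
theorem exists_sl2_meets_of_E_F_H_mem_latticeInfty {G : Subgroup (GL (Fin 2) ℤ_[ℓ])}
    (hE : (!![0, 1; 0, 0] : Matrix (Fin 2) (Fin 2) ℤ_[ℓ]) ∈
        closure (⋃ n : ℕ, {a : Matrix (Fin 2) (Fin 2) ℤ_[ℓ] | ∃ g ∈ G,
              (g : Matrix (Fin 2) (Fin 2) ℤ_[ℓ]).map ((↑) : ℤ_[ℓ] → ℚ_[ℓ]) =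
                NormedSpace.exp ((ℓ : ℚ_[ℓ]) ^ (n + 3) • a.map ((↑) : ℤ_[ℓ] → ℚ_[ℓ]))}))
    (hF : (!![0, 0; 1, 0] : Matrix (Fin 2) (Fin 2) ℤ_[ℓ]) ∈
        closure (⋃ n : ℕ, {a : Matrix (Fin 2) (Fin 2) ℤ_[ℓ] | ∃ g ∈ G,
              (g : Matrix (Fin 2) (Fin 2) ℤ_[ℓ]).map ((↑) : ℤ_[ℓ] → ℚ_[ℓ]) =
                NormedSpace.exp ((ℓ : ℚ_[ℓ]) ^ (n + 3) • a.map ((↑) : ℤ_[ℓ] → ℚ_[ℓ]))}))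
    (hH : (!![1, 0; 0, -1] : Matrix (Fin 2) (Fin 2) ℤ_[ℓ]) ∈
        closure (⋃ n : ℕ, {a : Matrix (Fin 2) (Fin 2) ℤ_[ℓ] | ∃ g ∈ G,
              (g : Matrix (Fin 2) (Fin 2) ℤ_[ℓ]).map ((↑) : ℤ_[ℓ] → ℚ_[ℓ]) =
                NormedSpace.exp ((ℓ : ℚ_[ℓ]) ^ (n + 3) • a.map ((↑) : ℤ_[ℓ] → ℚ_[ℓ]))})) :
    ∃ s, 2 ≤ s ∧ ∀ a : Matrix (Fin 2) (Fin 2) ℤ_[ℓ], (ℓ : ℤ_[ℓ]) ∣ a.trace → ∃ g ∈ G,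
      (g : Matrix (Fin 2) (Fin 2) ℤ_[ℓ]).det = 1 ∧
      (g : Matrix (Fin 2) (Fin 2) ℤ_[ℓ]).map (PadicInt.toZModPow (s + 1)) =
        (1 + (ℓ : ℤ_[ℓ]) ^ s • a).map (PadicInt.toZModPow (s + 1)) := by
  have hp : ℓ.Prime := Fact.out
  set E' : Matrix (Fin 2) (Fin 2) ℤ_[ℓ] := !![0, 1; 0, 0] with hE'
  set F' : Matrix (Fin 2) (Fin 2) ℤ_[ℓ] := !![0, 0; 1, 0] with hF'
  set H' : Matrix (Fin 2) (Fin 2) ℤ_[ℓ] := !![1, 0; 0, -1] with hH'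
  -- approximate modulo `ℓ²` inside one lattice `Λₜ(G)`
  obtain ⟨ue, hue, hueE⟩ := exists_dvd_sub_of_mem_closure hE 2
  obtain ⟨uf, huf, hufF⟩ := exists_dvd_sub_of_mem_closure hF 2
  obtain ⟨uh, huh, huhH⟩ := exists_dvd_sub_of_mem_closure hH 2
  obtain ⟨t, ht, hue', huf', huh'⟩ := exists_mem_lattice_three hue huf huh
  -- exact first-order forms at levels `t` and `t + 1`
  obtain ⟨ge, hgeG, xe, hge, hxe⟩ := exists_eq_one_add_smul_of_mem_lattice ht hue' hueE
  obtain ⟨gf, hgfG, xf, hgf, hxf⟩ := exists_eq_one_add_smul_of_mem_lattice ht huf' hufF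
  obtain ⟨gh, hghG, xh, hgh, hxh⟩ := exists_eq_one_add_smul_of_mem_lattice ht huh' huhH
  obtain ⟨Ge, hGeG, Xe, hGe, hXe⟩ := exists_eq_one_add_smul_of_mem_lattice (by omega) (mem_lattice_succ ht hue') hueE
  obtain ⟨Gh, hGhG, Xh, hGh, hXh⟩ := exists_eq_one_add_smul_of_mem_lattice (by omega) (mem_lattice_succ ht huh') huhH
  -- weaken `mod ℓ²` to `mod ℓ`
  have weak : ∀ {x c : Matrix (Fin 2) (Fin 2) ℤ_[ℓ]}, (∀ i j, (ℓ : ℤ_[ℓ]) ^ 2 ∣ (x - c) i j) →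
      ∀ i j, (ℓ : ℤ_[ℓ]) ^ 1 ∣ (x - c) i j :=
    fun h i j ↦ (pow_dvd_pow (ℓ : ℤ_[ℓ]) (by norm_num : 1 ≤ 2)).trans (h i j)
  -- the class of `H` at level `2t + 1`: the commutator `(exp ℓ^{t+1} E, exp ℓᵗ F)`
  have hHclass : ∃ g ∈ G, (g : Matrix (Fin 2) (Fin 2) ℤ_[ℓ]).det = 1 ∧
      (g : Matrix (Fin 2) (Fin 2) ℤ_[ℓ]).map (PadicInt.toZModPow (2 * t + 1 + 1)) =
        (1 + (ℓ : ℤ_[ℓ]) ^ (2 * t + 1) • H').map (PadicInt.toZModPow (2 * t + 1 + 1)) := by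
    have hC := pow_dvd_bracket_sub_bracket (weak hXe) (weak hxf)
    rw [bracket_E_F] at hC
    obtain ⟨g, hg, hg1, hgm⟩ := exists_det_one_map_eq_of_bracket (m := 1) (by omega) (by omega) hGeG hgfG hGe hgf hC
    refine ⟨g, hg, hg1, ?_⟩
    rw [show 2 * t + 1 + 1 = t + 1 + t + 1 by ring, show 2 * t + 1 = t + 1 + t by ring]
    exact hgm
  rcases hp.eq_two_or_odd' with h2 | hodd
  · /- `ℓ = 2`: the commutators `(exp ℓᵗH, exp ℓᵗE) ≡ 1 + ℓ^{2t}·2E = 1 + ℓ^{2t+1} E` and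
      `(exp ℓᵗH, exp ℓᵗF) ≡ 1 − ℓ^{2t+1} F ≡ 1 + ℓ^{2t+1} F` modulo `ℓ^{2t+2}` -/
    subst h2
    refine ⟨2 * t + 1, by omega, sl2_meets_of_three (by omega) ?_ ?_ hHclass⟩
    · have hC := pow_dvd_bracket_sub_bracket hxh hxe
      rw [bracket_H_E] at hC
      obtain ⟨g, hg, hg1, hgm⟩ := exists_det_one_map_eq_of_bracket (m := 2) (by omega) (by omega) hghG hgeG hgh hge hC
      refine ⟨g, hg, hg1, ?_⟩
      rw [show 2 * t + 1 + 1 = t + t + 2 by ring, hgm]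
      refine (map_toZModPow_eq_iff _ _ _).2 fun i j ↦ ⟨0, ?_⟩
      simp only [Matrix.add_apply, Matrix.smul_apply, smul_eq_mul, Nat.cast_ofNat]
      ring
    · have hC := pow_dvd_bracket_sub_bracket hxh hxf
      rw [bracket_H_F] at hC
      obtain ⟨g, hg, hg1, hgm⟩ := exists_det_one_map_eq_of_bracket (m := 2) (by omega) (by omega) hghG hgfG hgh hgf hC
      refine ⟨g, hg, hg1, ?_⟩
      rw [show 2 * t + 1 + 1 = t + t + 2 by ring, hgm]
      refine (map_toZModPow_eq_iff _ _ _).2 fun i j ↦ ⟨-F' i j, ?_⟩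
      simp only [Matrix.add_apply, Matrix.smul_apply, smul_eq_mul, Nat.cast_ofNat]
      ring
  · /- `ℓ` odd: `(exp ℓ^{t+1}H, exp ℓᵗE) ≡ 1 + ℓ^{2t+1}·2E`, then the power `(ℓ+1)/2`;
      `(exp ℓ^{t+1}H, exp ℓᵗF) ≡ 1 − ℓ^{2t+1}·2F`, then the power `(ℓ−1)/2` -/
    have hℓodd : 2 * (ℓ / 2) + 1 = ℓ := Nat.two_mul_div_two_add_one_of_odd hodd
    refine ⟨2 * t + 1, by omega, sl2_meets_of_three (by omega) ?_ ?_ hHclass⟩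
    · have hC := pow_dvd_bracket_sub_bracket (weak hXh) (weak hxe)
      rw [bracket_H_E] at hC
      obtain ⟨g, hg, hg1, hgm⟩ := exists_det_one_map_eq_of_bracket (m := 1) (by omega) (by omega) hGhG hgeG hGh hge hC
      rw [show t + 1 + t + 1 = 2 * t + 1 + 1 by ring, show t + 1 + t = 2 * t + 1 by ring] at hgm
      refine ⟨g ^ (ℓ / 2 + 1), G.pow_mem hg _, ?_, ?_⟩
      · rw [Units.val_pow_eq_pow_val, det_pow, hg1, one_pow]
      · rw [Units.val_pow_eq_pow_val, map_pow_of_map_eq (by omega) hgm]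
        refine map_one_add_smul_eq_of_dvd_sub fun i j ↦ ⟨E' i j, ?_⟩
        simp only [Matrix.smul_apply, smul_eq_mul]
        have hc : ((ℓ / 2 + 1 : ℕ) : ℤ_[ℓ]) * 2 = ℓ + 1 := by
          have : (ℓ / 2 + 1) * 2 = ℓ + 1 := by omega
          exact_mod_cast this
        linear_combination E' i j * hc
    · have hC := pow_dvd_bracket_sub_bracket (weak hXh) (weak hxf)
      rw [bracket_H_F] at hC
      obtain ⟨g, hg, hg1, hgm⟩ := exists_det_one_map_eq_of_bracket (m := 1) (by omega) (by omega) hGhG hgfG hGh hgf hC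
      rw [show t + 1 + t + 1 = 2 * t + 1 + 1 by ring, show t + 1 + t = 2 * t + 1 by ring] at hgm
      refine ⟨g ^ (ℓ / 2), G.pow_mem hg _, ?_, ?_⟩
      · rw [Units.val_pow_eq_pow_val, det_pow, hg1, one_pow]
      · rw [Units.val_pow_eq_pow_val, map_pow_of_map_eq (by omega) hgm]
        refine map_one_add_smul_eq_of_dvd_sub fun i j ↦ ⟨-F' i j, ?_⟩
        simp only [Matrix.smul_apply, smul_eq_mul]
        have hc : ((ℓ / 2 : ℕ) : ℤ_[ℓ]) * 2 = ℓ - 1 := by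
          have : (ℓ / 2) * 2 + 1 = ℓ := by omega
          rw [eq_sub_iff_add_eq]
          exact_mod_cast this
        linear_combination (-F' i j) * hc

/-! ### Determinant one: `det (exp A) = 1` for trace-free `A` -/

/-- Conjugation by an integral matrix with integral inverse commutes with `exp` on the box of
level `s ≥ 3`. [folklore] -/
theorem exp_conj_of_box {s : ℕ} (hs : 3 ≤ s) {A U V : Matrix (Fin 2) (Fin 2) ℚ_[ℓ]}
    (hA : ∀ i j, ‖A i j‖ ≤ (ℓ : ℝ) ^ (-(s : ℤ))) (hU : ∀ i j, ‖U i j‖ ≤ (ℓ : ℝ) ^ (-(0 : ℤ)))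
    (hV : ∀ i j, ‖V i j‖ ≤ (ℓ : ℝ) ^ (-(0 : ℤ))) (hVU : V * U = 1) :
    exp (U * A * V) = U * exp A * V := by
  have hbox : ∀ i j, ‖(U * A * V) i j‖ ≤ (ℓ : ℝ) ^ (-(s : ℤ)) := by
    have h := box_mul (box_mul hU hA) hV
    simpa using h
  have hpow : ∀ n : ℕ, (U * A * V) ^ n = U * A ^ n * V := by
    intro n
    induction n with
    | zero => rw [pow_zero, pow_zero, mul_one]; exact (mul_eq_one_comm.1 hVU).symm
    | succ n ih =>
      rw [pow_succ, ih, pow_succ]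
      simp only [mul_assoc]
      rw [← mul_assoc V U, hVU, one_mul]
  have h1 : HasSum (fun n ↦ (n !⁻¹ : ℚ_[ℓ]) • (U * A * V) ^ n) (exp (U * A * V)) := hasSum_exp_of_box hs hbox
  have h2 : HasSum (fun n ↦ U * ((n !⁻¹ : ℚ_[ℓ]) • A ^ n) * V) (U * exp A * V) :=
    ((hasSum_exp_of_box hs hA).mul_left U).mul_right V
  have heq : (fun n ↦ (n !⁻¹ : ℚ_[ℓ]) • (U * A * V) ^ n) = fun n ↦ U * ((n !⁻¹ : ℚ_[ℓ]) • A ^ n) * V := by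
    funext n
    rw [hpow n, mul_smul_comm, smul_mul_assoc]
  rw [heq] at h1
  exact h1.unique h2

/-- **`det (exp A) = 1` for trace-free `A`** in the box of level `s ≥ 3`: `−Aᵀ = J A J⁻¹` with
`J = (0 1; −1 0)`, so `exp(−A) = (J exp(A) J⁻¹)ᵀ` has the same determinant as `exp A`; as
`exp(−A) exp(A) = 1` this gives `det(exp A)² = 1`, and `det(exp A) ≡ 1 (mod ℓˢ)` excludes `−1`.
(No identity `det ∘ exp = exp ∘ tr` is needed.) [folklore] -/
theorem det_exp_eq_one_of_trace_eq_zero {s : ℕ} (hs : 3 ≤ s) {A : Matrix (Fin 2) (Fin 2) ℚ_[ℓ]}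
    (hA : ∀ i j, ‖A i j‖ ≤ (ℓ : ℝ) ^ (-(s : ℤ))) (htr : A.trace = 0) : (exp A).det = 1 := by
  have hp : ℓ.Prime := Fact.out
  set J : Matrix (Fin 2) (Fin 2) ℚ_[ℓ] := !![0, 1; -1, 0] with hJ
  have hJbox : ∀ i j, ‖J i j‖ ≤ (ℓ : ℝ) ^ (-(0 : ℤ)) := by
    intro i j; rw [neg_zero, zpow_zero]
    fin_cases i <;> fin_cases j <;> simp [hJ]
  have hJ' : ∀ i j, ‖(-J) i j‖ ≤ (ℓ : ℝ) ^ (-(0 : ℤ)) := box_neg hJbox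
  have hJJ : (-J) * J = 1 := by
    ext i j; fin_cases i <;> fin_cases j <;> simp [hJ]
  have hA11 : A 1 1 = -A 0 0 := by
    rw [Matrix.trace_fin_two] at htr; linear_combination htr
  have hconj : J * A * (-J) = -Aᵀ := by
    ext i j
    fin_cases i <;> fin_cases j <;> simp [hJ, Matrix.mul_apply, Fin.sum_univ_two, hA11, Matrix.vecMul, dotProduct]
  -- `det (exp (-A)) = det (exp A)`
  have hdet : (exp (-A)).det = (exp A).det := by
    have h1 : exp (-A) = (exp (-Aᵀ))ᵀ := by
      rw [← Matrix.transpose_neg, Matrix.exp_transpose, Matrix.transpose_transpose]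
    rw [h1, Matrix.det_transpose, ← hconj, exp_conj_of_box hs hA hJbox hJ' hJJ, Matrix.det_mul,
      Matrix.det_mul, mul_comm (J.det * (exp A).det), ← mul_assoc, ← Matrix.det_mul, hJJ, Matrix.det_one,
      one_mul]
  -- `det (exp A) ^ 2 = 1`
  have hsq : (exp A).det * (exp A).det = 1 := by
    have h := congrArg Matrix.det (exp_neg_of_box hs hA).1
    rwa [Matrix.det_mul, hdet, Matrix.det_one] at h
  -- `det (exp A) ≡ 1 (mod ℓˢ)`
  obtain ⟨g, hg, hgA⟩ := exists_mem_congruenceSubgroup_map_eq_exp hs hA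
  have hdetg : (exp A).det = ((g : Matrix (Fin 2) (Fin 2) ℤ_[ℓ]).det : ℚ_[ℓ]) := by
    rw [← hgA]
    exact (RingHom.map_det (PadicInt.Coe.ringHom (p := ℓ)) _).symm
  have hnorm : ‖(exp A).det - 1‖ ≤ (ℓ : ℝ) ^ (-(s : ℤ)) := by
    rw [hdetg, ← PadicInt.coe_one, ← PadicInt.coe_sub, ← PadicInt.norm_def, PadicInt.norm_le_pow_iff_mem_span_pow,
      Ideal.mem_span_singleton]
    exact pow_dvd_det_sub_one hg
  -- hence `det (exp A) = 1`
  rcases mul_self_eq_one_iff.1 hsq with h | h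
  · exact h
  · exfalso
    rw [h, show (-1 : ℚ_[ℓ]) - 1 = -2 by norm_num, norm_neg] at hnorm
    have h2 : (ℓ : ℝ)⁻¹ ≤ ‖(2 : ℚ_[ℓ])‖ := by
      -- `‖2‖_ℓ = ℓ^{-v_ℓ(2)} ≥ ℓ⁻¹` since `v_ℓ(2) ≤ 1`
      have h2ne : ((2 : ℕ) : ℚ_[ℓ]) ≠ 0 := Nat.cast_ne_zero.2 two_ne_zero
      have hv : ‖((2 : ℕ) : ℚ_[ℓ])‖ = (ℓ : ℝ) ^ (-(padicValNat ℓ 2 : ℤ)) := by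
        rw [Padic.norm_eq_zpow_neg_valuation h2ne, Padic.valuation_natCast]
      have hle : padicValNat ℓ 2 ≤ 1 := by
        have h := pow_padicValNat_dvd (p := ℓ) (n := 2)
        have h2 : ℓ ^ padicValNat ℓ 2 ≤ 2 := Nat.le_of_dvd two_pos h
        by_contra hgt
        push Not at hgt
        have : ℓ ^ 2 ≤ ℓ ^ padicValNat ℓ 2 := Nat.pow_le_pow_right hp.pos hgt
        have : 4 ≤ ℓ ^ 2 := by nlinarith [hp.two_le]
        omega
      rw [Nat.cast_ofNat] at hv
      rw [hv, ← _root_.zpow_neg_one]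
      exact zpow_le_zpow_right₀ (by exact_mod_cast hp.one_lt.le) (by omega)
    have hℓ1 : (1 : ℝ) < ℓ := by exact_mod_cast hp.one_lt
    have h3 : (ℓ : ℝ) ^ (-(s : ℤ)) < (ℓ : ℝ)⁻¹ := by
      rw [← _root_.zpow_neg_one]
      exact zpow_lt_zpow_right₀ hℓ1 (by omega)
    linarith

/-! ### From `E, F, H` and a non-trace-free element to all of `M₂(ℤ_ℓ)` -/

/-- If `E, F, H ∈ Λ∞(G)` then every trace-free integral matrix lies in `Λ∞(G)`. [folklore] -/
theorem mem_latticeInfty_of_trace_eq_zero {G : Subgroup (GL (Fin 2) ℤ_[ℓ])}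
    (hE : (!![0, 1; 0, 0] : Matrix (Fin 2) (Fin 2) ℤ_[ℓ]) ∈
        closure (⋃ n : ℕ, {a : Matrix (Fin 2) (Fin 2) ℤ_[ℓ] | ∃ g ∈ G,
              (g : Matrix (Fin 2) (Fin 2) ℤ_[ℓ]).map ((↑) : ℤ_[ℓ] → ℚ_[ℓ]) =
                NormedSpace.exp ((ℓ : ℚ_[ℓ]) ^ (n + 3) • a.map ((↑) : ℤ_[ℓ] → ℚ_[ℓ]))}))
    (hF : (!![0, 0; 1, 0] : Matrix (Fin 2) (Fin 2) ℤ_[ℓ]) ∈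
        closure (⋃ n : ℕ, {a : Matrix (Fin 2) (Fin 2) ℤ_[ℓ] | ∃ g ∈ G,
              (g : Matrix (Fin 2) (Fin 2) ℤ_[ℓ]).map ((↑) : ℤ_[ℓ] → ℚ_[ℓ]) =
                NormedSpace.exp ((ℓ : ℚ_[ℓ]) ^ (n + 3) • a.map ((↑) : ℤ_[ℓ] → ℚ_[ℓ]))}))
    (hH : (!![1, 0; 0, -1] : Matrix (Fin 2) (Fin 2) ℤ_[ℓ]) ∈
        closure (⋃ n : ℕ, {a : Matrix (Fin 2) (Fin 2) ℤ_[ℓ] | ∃ g ∈ G,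
              (g : Matrix (Fin 2) (Fin 2) ℤ_[ℓ]).map ((↑) : ℤ_[ℓ] → ℚ_[ℓ]) =
                NormedSpace.exp ((ℓ : ℚ_[ℓ]) ^ (n + 3) • a.map ((↑) : ℤ_[ℓ] → ℚ_[ℓ]))}))
    {x : Matrix (Fin 2) (Fin 2) ℤ_[ℓ]} (hx : x.trace = 0) : x ∈
        closure (⋃ n : ℕ, {a : Matrix (Fin 2) (Fin 2) ℤ_[ℓ] | ∃ g ∈ G,
              (g : Matrix (Fin 2) (Fin 2) ℤ_[ℓ]).map ((↑) : ℤ_[ℓ] → ℚ_[ℓ]) =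
                NormedSpace.exp ((ℓ : ℚ_[ℓ]) ^ (n + 3) • a.map ((↑) : ℤ_[ℓ] → ℚ_[ℓ]))}) := by
  have h11 : x 1 1 = -x 0 0 := by rw [Matrix.trace_fin_two] at hx; linear_combination hx
  have he : x = x 0 1 • (!![0, 1; 0, 0] : Matrix (Fin 2) (Fin 2) ℤ_[ℓ]) + x 1 0 • !![0, 0; 1, 0] + x 0 0 • !![1, 0; 0, -1] := by
    ext i j; fin_cases i <;> fin_cases j <;> simp [h11]
  rw [he]
  exact add_mem_latticeInfty (add_mem_latticeInfty (smul_mem_latticeInfty hE _) (smul_mem_latticeInfty hF _))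
    (smul_mem_latticeInfty hH _)

/-- **The Lie lattice is everything** once it contains `𝔰𝔩₂(ℤ_ℓ)` and one element of nonzero
trace (saturation: `tr(a) E₁₁ ∈ Λ∞(G)` and `tr(a) = ℓᵛ · unit`). [folklore] -/
theorem mem_latticeInfty_of_trace_ne_zero {G : Subgroup (GL (Fin 2) ℤ_[ℓ])}
    (hsl : ∀ x : Matrix (Fin 2) (Fin 2) ℤ_[ℓ], x.trace = 0 → x ∈
        closure (⋃ n : ℕ, {a : Matrix (Fin 2) (Fin 2) ℤ_[ℓ] | ∃ g ∈ G,
              (g : Matrix (Fin 2) (Fin 2) ℤ_[ℓ]).map ((↑) : ℤ_[ℓ] → ℚ_[ℓ]) =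
                NormedSpace.exp ((ℓ : ℚ_[ℓ]) ^ (n + 3) • a.map ((↑) : ℤ_[ℓ] → ℚ_[ℓ]))}))
    {a : Matrix (Fin 2) (Fin 2) ℤ_[ℓ]} (ha : a ∈ closure (⋃ n : ℕ, {a : Matrix (Fin 2) (Fin 2) ℤ_[ℓ] | ∃ g ∈ G,
          (g : Matrix (Fin 2) (Fin 2) ℤ_[ℓ]).map ((↑) : ℤ_[ℓ] → ℚ_[ℓ]) =
            NormedSpace.exp ((ℓ : ℚ_[ℓ]) ^ (n + 3) • a.map ((↑) : ℤ_[ℓ] → ℚ_[ℓ]))})) (hta : a.trace ≠ 0) (x : Matrix (Fin 2) (Fin 2) ℤ_[ℓ]) :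
    x ∈ closure (⋃ n : ℕ, {a : Matrix (Fin 2) (Fin 2) ℤ_[ℓ] | ∃ g ∈ G,
          (g : Matrix (Fin 2) (Fin 2) ℤ_[ℓ]).map ((↑) : ℤ_[ℓ] → ℚ_[ℓ]) =
            NormedSpace.exp ((ℓ : ℚ_[ℓ]) ^ (n + 3) • a.map ((↑) : ℤ_[ℓ] → ℚ_[ℓ]))}) := by
  set E₁₁ : Matrix (Fin 2) (Fin 2) ℤ_[ℓ] := !![1, 0; 0, 0] with hE₁₁
  have htrE : ∀ c : ℤ_[ℓ], (c • E₁₁).trace = c := fun c ↦ by simp [hE₁₁, Matrix.trace_fin_two]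
  -- `tr(a) • E₁₁ ∈ Λ∞(G)`
  have h1 : a.trace • E₁₁ ∈ closure (⋃ n : ℕ, {a : Matrix (Fin 2) (Fin 2) ℤ_[ℓ] | ∃ g ∈ G,
        (g : Matrix (Fin 2) (Fin 2) ℤ_[ℓ]).map ((↑) : ℤ_[ℓ] → ℚ_[ℓ]) =
          NormedSpace.exp ((ℓ : ℚ_[ℓ]) ^ (n + 3) • a.map ((↑) : ℤ_[ℓ] → ℚ_[ℓ]))}) := by
    have h := sub_mem_latticeInfty ha (hsl (a - a.trace • E₁₁) (by rw [Matrix.trace_sub, htrE, sub_self]))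
    rwa [sub_sub_cancel] at h
  -- `E₁₁ ∈ Λ∞(G)` by saturation
  have h2 : E₁₁ ∈ closure (⋃ n : ℕ, {a : Matrix (Fin 2) (Fin 2) ℤ_[ℓ] | ∃ g ∈ G,
        (g : Matrix (Fin 2) (Fin 2) ℤ_[ℓ]).map ((↑) : ℤ_[ℓ] → ℚ_[ℓ]) =
          NormedSpace.exp ((ℓ : ℚ_[ℓ]) ^ (n + 3) • a.map ((↑) : ℤ_[ℓ] → ℚ_[ℓ]))}) := by
    set u := PadicInt.unitCoeff hta with hu
    have hspec := PadicInt.unitCoeff_spec hta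
    rw [hspec, mul_comm, mul_smul] at h1
    have h3 : (u : ℤ_[ℓ]) • E₁₁ ∈ closure (⋃ n : ℕ, {a : Matrix (Fin 2) (Fin 2) ℤ_[ℓ] | ∃ g ∈ G,
          (g : Matrix (Fin 2) (Fin 2) ℤ_[ℓ]).map ((↑) : ℤ_[ℓ] → ℚ_[ℓ]) =
            NormedSpace.exp ((ℓ : ℚ_[ℓ]) ^ (n + 3) • a.map ((↑) : ℤ_[ℓ] → ℚ_[ℓ]))}) := mem_latticeInfty_of_pow_smul_mem h1
    have h4 := smul_mem_latticeInfty h3 ((u⁻¹ : ℤ_[ℓ]ˣ) : ℤ_[ℓ])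
    rwa [smul_smul, Units.inv_mul, one_smul] at h4
  have h3 : x = (x - x.trace • E₁₁) + x.trace • E₁₁ := by rw [sub_add_cancel]
  rw [h3]
  exact add_mem_latticeInfty (hsl _ (by rw [Matrix.trace_sub, htrE, sub_self])) (smul_mem_latticeInfty h2 _)

/-- **If `Λ∞(G) = M₂(ℤ_ℓ)` then `G` meets every class of `Γ(ℓˢ)/Γ(ℓ^{s+1})` at some level
`s ≥ 2`** (the hypothesis of `OpenImage.congruenceSubgroup_le_of_isClosed` /
`isOpen_range_of_meets`): approximate `E₁₁, E₁₂, E₂₁, E₂₂` modulo `ℓ` inside one `Λₜ(G)`,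
exponentiate (`exp (ℓᵗ u) ≡ 1 + ℓᵗ u`), and multiply powers. [folklore] -/
theorem exists_meets_of_forall_mem_latticeInfty {G : Subgroup (GL (Fin 2) ℤ_[ℓ])}
    (h : ∀ x : Matrix (Fin 2) (Fin 2) ℤ_[ℓ], x ∈ closure (⋃ n : ℕ, {a : Matrix (Fin 2) (Fin 2) ℤ_[ℓ] | ∃ g ∈ G,
          (g : Matrix (Fin 2) (Fin 2) ℤ_[ℓ]).map ((↑) : ℤ_[ℓ] → ℚ_[ℓ]) =
            NormedSpace.exp ((ℓ : ℚ_[ℓ]) ^ (n + 3) • a.map ((↑) : ℤ_[ℓ] → ℚ_[ℓ]))})) :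
    ∃ s, 2 ≤ s ∧ ∀ a : Matrix (Fin 2) (Fin 2) ℤ_[ℓ], ∃ g ∈ G,
      (g : Matrix (Fin 2) (Fin 2) ℤ_[ℓ]).map (PadicInt.toZModPow (s + 1)) =
        (1 + (ℓ : ℤ_[ℓ]) ^ s • a).map (PadicInt.toZModPow (s + 1)) := by
  -- approximate the four elementary matrices modulo `ℓ` in a common lattice
  have approx : ∀ b : Matrix (Fin 2) (Fin 2) ℤ_[ℓ], ∃ u ∈ ⋃ n : ℕ, {a : Matrix (Fin 2) (Fin 2) ℤ_[ℓ] | ∃ g ∈ G,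
        (g : Matrix (Fin 2) (Fin 2) ℤ_[ℓ]).map ((↑) : ℤ_[ℓ] → ℚ_[ℓ]) =
          NormedSpace.exp ((ℓ : ℚ_[ℓ]) ^ (n + 3) • a.map ((↑) : ℤ_[ℓ] → ℚ_[ℓ]))}, ∀ i j, (ℓ : ℤ_[ℓ]) ^ 1 ∣ (u - b) i j :=
    fun b ↦ exists_dvd_sub_of_mem_closure (h b) 1
  obtain ⟨u₁, hu₁, hu₁b⟩ := approx !![1, 0; 0, 0]
  obtain ⟨u₂, hu₂, hu₂b⟩ := approx !![0, 1; 0, 0]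
  obtain ⟨u₃, hu₃, hu₃b⟩ := approx !![0, 0; 1, 0]
  obtain ⟨u₄, hu₄, hu₄b⟩ := approx !![0, 0; 0, 1]
  obtain ⟨t₀, ht₀, h₁, h₂, h₃⟩ := exists_mem_lattice_three hu₁ hu₂ hu₃
  obtain ⟨m, hm⟩ := Set.mem_iUnion.1 hu₄
  set t := t₀ + m + 3 with ht
  have h₁' := mem_lattice_of_le ht₀ (by omega : t₀ ≤ t) h₁
  have h₂' := mem_lattice_of_le ht₀ (by omega : t₀ ≤ t) h₂
  have h₃' := mem_lattice_of_le ht₀ (by omega : t₀ ≤ t) h₃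
  have h₄' := mem_lattice_of_le (by omega : 3 ≤ m + 3) (by omega : m + 3 ≤ t) hm
  -- elements of `G` in the classes of the elementary matrices at level `t`
  have elem : ∀ {u b : Matrix (Fin 2) (Fin 2) ℤ_[ℓ]}, u ∈ {a : Matrix (Fin 2) (Fin 2) ℤ_[ℓ] | ∃ g ∈ G,
        (g : Matrix (Fin 2) (Fin 2) ℤ_[ℓ]).map ((↑) : ℤ_[ℓ] → ℚ_[ℓ]) =
          NormedSpace.exp ((ℓ : ℚ_[ℓ]) ^ t • a.map ((↑) : ℤ_[ℓ] → ℚ_[ℓ]))} → (∀ i j, (ℓ : ℤ_[ℓ]) ^ 1 ∣ (u - b) i j) →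
      ∃ g ∈ G, (g : Matrix (Fin 2) (Fin 2) ℤ_[ℓ]).map (PadicInt.toZModPow (t + 1)) =
        (1 + (ℓ : ℤ_[ℓ]) ^ t • b).map (PadicInt.toZModPow (t + 1)) := by
    intro u b hu hub
    obtain ⟨g, hg, hgu⟩ := hu
    refine ⟨g, hg, ?_⟩
    rw [map_toZModPow_eq_of_map_eq_exp (by omega) (by omega) hgu]
    exact map_one_add_smul_eq_of_dvd_sub fun i j ↦ by rw [← Matrix.sub_apply, ← pow_one (ℓ : ℤ_[ℓ])]; exact hub i j
  obtain ⟨g₁, hg₁G, hg₁⟩ := elem h₁' hu₁b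
  obtain ⟨g₂, hg₂G, hg₂⟩ := elem h₂' hu₂b
  obtain ⟨g₃, hg₃G, hg₃⟩ := elem h₃' hu₃b
  obtain ⟨g₄, hg₄G, hg₄⟩ := elem h₄' hu₄b
  refine ⟨t, by omega, fun a ↦ ?_⟩
  have hrep : ∀ n : ℤ_[ℓ], (ℓ : ℤ_[ℓ]) ∣ (PadicInt.zmodRepr n : ℤ_[ℓ]) - n := by
    intro n
    have h := PadicInt.sub_zmodRepr_mem n
    rw [PadicInt.maximalIdeal_eq_span_p, Ideal.mem_span_singleton] at h
    rw [← dvd_neg, neg_sub]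
    exact h
  set k₁ := PadicInt.zmodRepr (a 0 0)
  set k₂ := PadicInt.zmodRepr (a 0 1)
  set k₃ := PadicInt.zmodRepr (a 1 0)
  set k₄ := PadicInt.zmodRepr (a 1 1)
  refine ⟨g₁ ^ k₁ * g₂ ^ k₂ * g₃ ^ k₃ * g₄ ^ k₄,
    G.mul_mem (G.mul_mem (G.mul_mem (G.pow_mem hg₁G _) (G.pow_mem hg₂G _)) (G.pow_mem hg₃G _)) (G.pow_mem hg₄G _), ?_⟩
  have ht1 : 1 ≤ t := by omega
  have e1 := map_pow_of_map_eq ht1 hg₁ k₁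
  have e2 := map_pow_of_map_eq ht1 hg₂ k₂
  have e3 := map_pow_of_map_eq ht1 hg₃ k₃
  have e4 := map_pow_of_map_eq ht1 hg₄ k₄
  rw [← Units.val_pow_eq_pow_val] at e1 e2 e3 e4
  have e12 := map_mul_of_map_eq ht1 e1 e2
  rw [← Units.val_mul] at e12
  have e123 := map_mul_of_map_eq ht1 e12 e3
  rw [← Units.val_mul] at e123
  have e1234 := map_mul_of_map_eq ht1 e123 e4
  rw [← Units.val_mul] at e1234
  rw [e1234]
  have hcomb : (k₁ : ℤ_[ℓ]) • (!![1, 0; 0, 0] : Matrix (Fin 2) (Fin 2) ℤ_[ℓ]) + (k₂ : ℤ_[ℓ]) • !![0, 1; 0, 0] +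
      (k₃ : ℤ_[ℓ]) • !![0, 0; 1, 0] + (k₄ : ℤ_[ℓ]) • !![0, 0; 0, 1] =
      !![(k₁ : ℤ_[ℓ]), (k₂ : ℤ_[ℓ]); (k₃ : ℤ_[ℓ]), (k₄ : ℤ_[ℓ])] := by
    ext i j; fin_cases i <;> fin_cases j <;> simp
  rw [hcomb]
  refine map_one_add_smul_eq_of_dvd_sub fun i j ↦ ?_
  fin_cases i <;> fin_cases j
  · simpa using hrep (a 0 0)
  · simpa using hrep (a 0 1)
  · simpa using hrep (a 1 0)
  · simpa using hrep (a 1 1)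

/-! ### The engine -/

/-- **`E, F, H ∈ Λ∞(G)` when `G ∩ Γ(ℓ³)` has no invariant line.**  Let `G ≤ GL₂(ℤ_ℓ)` be any
subgroup and `E ⊇ ℚ_ℓ` a field containing square roots of all elements of `ℚ_ℓ`.  If for every
`v ≠ 0` in `E²` some `g ∈ G ∩ Γ(ℓ³)` moves the line `E v`, then `E, F, H ∈ Λ∞(G)`
("`𝔤_ℓ ⊇ 𝔰𝔩₂`"): the `ℚ_ℓ`-span `𝔤` of `Λ∞(G)` is a Lie subalgebra of `𝔤𝔩₂(ℚ_ℓ)`; if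
`𝔤 ⊉ 𝔰𝔩₂` it has an invariant line over `E` (`exists_eigenline_of_not_sl2_subset`), hence so
does `Λ₃(G) ⊆ 𝔤` and therefore `G ∩ Γ(ℓ³)` (`exists_mulVec_eq_smul_of_forall_mem_lattice`),
excluded; and `𝔤` has no new integral points (saturation). [cite: Ribet1985, §3 p. 191] -/
theorem E_F_H_mem_latticeInfty_of_forall_exists_not_eigenline {G : Subgroup (GL (Fin 2) ℤ_[ℓ])}
    {E : Type*} [Field E] [Algebra ℚ_[ℓ] E]
    (hsq : ∀ d : ℚ_[ℓ], ∃ μ : E, μ * μ = algebraMap ℚ_[ℓ] E d)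
    (hirr : ∀ v : Fin 2 → E, v ≠ 0 → ∃ g ∈ G, g ∈ GL2.congruenceSubgroup (p := ℓ) 3 ∧
      ¬ ∃ c : E, (((g : Matrix (Fin 2) (Fin 2) ℤ_[ℓ]).map ((↑) : ℤ_[ℓ] → ℚ_[ℓ])).map (algebraMap ℚ_[ℓ] E)) *ᵥ v = c • v) :
    (!![0, 1; 0, 0] : Matrix (Fin 2) (Fin 2) ℤ_[ℓ]) ∈
        closure (⋃ n : ℕ, {a : Matrix (Fin 2) (Fin 2) ℤ_[ℓ] | ∃ g ∈ G,
              (g : Matrix (Fin 2) (Fin 2) ℤ_[ℓ]).map ((↑) : ℤ_[ℓ] → ℚ_[ℓ]) =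
                NormedSpace.exp ((ℓ : ℚ_[ℓ]) ^ (n + 3) • a.map ((↑) : ℤ_[ℓ] → ℚ_[ℓ]))}) ∧ (!![0, 0; 1, 0] : Matrix (Fin 2) (Fin 2) ℤ_[ℓ]) ∈
                    closure (⋃ n : ℕ, {a : Matrix (Fin 2) (Fin 2) ℤ_[ℓ] | ∃ g ∈ G,
                          (g : Matrix (Fin 2) (Fin 2) ℤ_[ℓ]).map ((↑) : ℤ_[ℓ] → ℚ_[ℓ]) =
                            NormedSpace.exp ((ℓ : ℚ_[ℓ]) ^ (n + 3) • a.map ((↑) : ℤ_[ℓ] → ℚ_[ℓ]))}) ∧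
      (!![1, 0; 0, -1] : Matrix (Fin 2) (Fin 2) ℤ_[ℓ]) ∈
          closure (⋃ n : ℕ, {a : Matrix (Fin 2) (Fin 2) ℤ_[ℓ] | ∃ g ∈ G,
                (g : Matrix (Fin 2) (Fin 2) ℤ_[ℓ]).map ((↑) : ℤ_[ℓ] → ℚ_[ℓ]) =
                  NormedSpace.exp ((ℓ : ℚ_[ℓ]) ^ (n + 3) • a.map ((↑) : ℤ_[ℓ] → ℚ_[ℓ]))}) := by
  set Lie : Submodule ℚ_[ℓ] (Matrix (Fin 2) (Fin 2) ℚ_[ℓ]) :=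
    Submodule.span ℚ_[ℓ] ((fun a : Matrix (Fin 2) (Fin 2) ℤ_[ℓ] ↦ a.map ((↑) : ℤ_[ℓ] → ℚ_[ℓ])) ''
        closure (⋃ n : ℕ, {a : Matrix (Fin 2) (Fin 2) ℤ_[ℓ] | ∃ g ∈ G,
              (g : Matrix (Fin 2) (Fin 2) ℤ_[ℓ]).map ((↑) : ℤ_[ℓ] → ℚ_[ℓ]) =
                NormedSpace.exp ((ℓ : ℚ_[ℓ]) ^ (n + 3) • a.map ((↑) : ℤ_[ℓ] → ℚ_[ℓ]))})) with hLie
  have hbr : ∀ X ∈ Lie, ∀ Y ∈ Lie, X * Y - Y * X ∈ Lie := fun X hX Y hY ↦ bracket_mem_span_latticeInfty hX hY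
  by_cases hefh : ((!![0, 1; 0, 0] : Matrix (Fin 2) (Fin 2) ℚ_[ℓ]) ∈ Lie ∧
      (!![0, 0; 1, 0] : Matrix (Fin 2) (Fin 2) ℚ_[ℓ]) ∈ Lie ∧ (!![1, 0; 0, -1] : Matrix (Fin 2) (Fin 2) ℚ_[ℓ]) ∈ Lie)
  · obtain ⟨he, hf, hh⟩ := hefh
    obtain ⟨hιe, hιf, hιh⟩ := map_coe_E_F_H (ℓ := ℓ)
    rw [← hιe] at he
    rw [← hιf] at hf
    rw [← hιh] at hh
    exact ⟨mem_latticeInfty_of_map_mem_span he, mem_latticeInfty_of_map_mem_span hf,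
      mem_latticeInfty_of_map_mem_span hh⟩
  · exfalso
    obtain ⟨v, hv, hvL⟩ := exists_eigenline_of_not_sl2_subset hsq Lie hbr hefh
    obtain ⟨g, hgG, hg3, hgv⟩ := hirr v hv
    refine hgv (exists_mulVec_eq_smul_of_forall_mem_lattice (G := G) (fun a ha ↦ ?_) hgG hg3)
    exact hvL _ (Submodule.subset_span ⟨a, lattice_subset_latticeInfty G le_rfl ha, rfl⟩)

/-- **The `ℓ`-adic Lie-algebra engine, `SL₂` form.**  Under the no-invariant-line hypothesis, at
some level `s ≥ 2` every class `1 + ℓˢ a (mod ℓ^{s+1})` with `ℓ ∣ tr a` contains an element of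
`G` of determinant `1` — hypothesis (1) of `OpenImage.isOpen_range_of_sl2_meets_of_det`
(successive approximation in `SL₂`, Serre IV-23); to be combined with the determinants.
This is the formal content of "`𝔤_ℓ ⊇ 𝔰𝔩₂`" in Ribet 1977, Thm. (5.7) / Ribet 1985, §3 (after
Serre). [cite: Ribet1985, §3 p. 191] -/
theorem exists_sl2_meets_of_forall_exists_not_eigenline {G : Subgroup (GL (Fin 2) ℤ_[ℓ])}
    {E : Type*} [Field E] [Algebra ℚ_[ℓ] E]
    (hsq : ∀ d : ℚ_[ℓ], ∃ μ : E, μ * μ = algebraMap ℚ_[ℓ] E d)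
    (hirr : ∀ v : Fin 2 → E, v ≠ 0 → ∃ g ∈ G, g ∈ GL2.congruenceSubgroup (p := ℓ) 3 ∧
      ¬ ∃ c : E, (((g : Matrix (Fin 2) (Fin 2) ℤ_[ℓ]).map ((↑) : ℤ_[ℓ] → ℚ_[ℓ])).map (algebraMap ℚ_[ℓ] E)) *ᵥ v = c • v) :
    ∃ s, 2 ≤ s ∧ ∀ a : Matrix (Fin 2) (Fin 2) ℤ_[ℓ], (ℓ : ℤ_[ℓ]) ∣ a.trace → ∃ g ∈ G,
      (g : Matrix (Fin 2) (Fin 2) ℤ_[ℓ]).det = 1 ∧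
      (g : Matrix (Fin 2) (Fin 2) ℤ_[ℓ]).map (PadicInt.toZModPow (s + 1)) =
        (1 + (ℓ : ℤ_[ℓ]) ^ s • a).map (PadicInt.toZModPow (s + 1)) := by
  obtain ⟨hE, hF, hH⟩ := E_F_H_mem_latticeInfty_of_forall_exists_not_eigenline hsq hirr
  exact exists_sl2_meets_of_E_F_H_mem_latticeInfty hE hF hH

/-- **The `ℓ`-adic Lie-algebra engine, `GL₂` form.**  Let `G ≤ GL₂(ℤ_ℓ)` be any subgroup such that
(1) `G ∩ Γ(ℓ³)` has no invariant line over a field `E ⊇ ℚ_ℓ` containing square roots of `ℚ_ℓ`,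
and (2) `G ∩ Γ(ℓ³)` contains an element of determinant `≠ 1`.  Then at some level `s ≥ 2` the
group `G` meets EVERY class of `Γ(ℓˢ)/Γ(ℓ^{s+1}) ≅ M₂(𝔽_ℓ)` — the hypothesis of
`OpenImage.congruenceSubgroup_le_of_isClosed` and `OpenImage.isOpen_range_of_meets`, so that the
closure of `G` contains `Γ(ℓˢ)` ("`𝔤_ℓ = 𝔤𝔩₂`, i.e. `G_ℓ` is open": Ribet 1985, Introduction (1)
and §3; Ribet 1977, Thm. (5.7)).  Indeed by (1) `𝔰𝔩₂(ℤ_ℓ) ⊆ Λ∞(G)`; by (2) some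
`g = exp (ℓ³ a) ∈ G` has `det g ≠ 1`, so `tr a ≠ 0` (`det_exp_eq_one_of_trace_eq_zero`), and
saturation gives `Λ∞(G) = M₂(ℤ_ℓ)`. [cite: Ribet1985, Introduction (1) and §3 p. 191] -/
theorem exists_meets_of_forall_exists_not_eigenline_of_det_ne_one {G : Subgroup (GL (Fin 2) ℤ_[ℓ])}
    {E : Type*} [Field E] [Algebra ℚ_[ℓ] E]
    (hsq : ∀ d : ℚ_[ℓ], ∃ μ : E, μ * μ = algebraMap ℚ_[ℓ] E d)
    (hirr : ∀ v : Fin 2 → E, v ≠ 0 → ∃ g ∈ G, g ∈ GL2.congruenceSubgroup (p := ℓ) 3 ∧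
      ¬ ∃ c : E, (((g : Matrix (Fin 2) (Fin 2) ℤ_[ℓ]).map ((↑) : ℤ_[ℓ] → ℚ_[ℓ])).map (algebraMap ℚ_[ℓ] E)) *ᵥ v = c • v)
    (hdet : ∃ g ∈ G, g ∈ GL2.congruenceSubgroup (p := ℓ) 3 ∧ (g : Matrix (Fin 2) (Fin 2) ℤ_[ℓ]).det ≠ 1) :
    ∃ s, 2 ≤ s ∧ ∀ a : Matrix (Fin 2) (Fin 2) ℤ_[ℓ], ∃ g ∈ G,
      (g : Matrix (Fin 2) (Fin 2) ℤ_[ℓ]).map (PadicInt.toZModPow (s + 1)) =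
        (1 + (ℓ : ℤ_[ℓ]) ^ s • a).map (PadicInt.toZModPow (s + 1)) := by
  obtain ⟨hE, hF, hH⟩ := E_F_H_mem_latticeInfty_of_forall_exists_not_eigenline hsq hirr
  obtain ⟨g, hgG, hg3, hgdet⟩ := hdet
  obtain ⟨a, ha, hga⟩ := exists_mem_lattice_of_mem le_rfl hgG hg3
  have hta : a.trace ≠ 0 := by
    intro hta
    apply hgdet
    have htr : ((ℓ : ℚ_[ℓ]) ^ 3 • a.map ((↑) : ℤ_[ℓ] → ℚ_[ℓ])).trace = 0 := by
      rw [Matrix.trace_smul, Matrix.trace_fin_two, Matrix.map_apply, Matrix.map_apply, ← PadicInt.coe_add,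
        ← Matrix.trace_fin_two, hta, PadicInt.coe_zero, smul_zero]
    have h := det_exp_eq_one_of_trace_eq_zero le_rfl (box_smul_map_coe 3 a) htr
    rw [← hga] at h
    have e := RingHom.map_det (PadicInt.Coe.ringHom (p := ℓ)) (g : Matrix (Fin 2) (Fin 2) ℤ_[ℓ])
    rw [RingHom.mapMatrix_apply] at e
    have h' : PadicInt.Coe.ringHom (p := ℓ) ((g : Matrix (Fin 2) (Fin 2) ℤ_[ℓ]).det) = 1 := e.trans h
    exact Subtype.val_injective (h'.trans PadicInt.coe_one.symm)
  refine exists_meets_of_forall_mem_latticeInfty (mem_latticeInfty_of_trace_ne_zero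
    (fun x hx ↦ mem_latticeInfty_of_trace_eq_zero hE hF hH hx) (lattice_subset_latticeInfty G le_rfl ha) hta)

end OpenImage

end Literature.NumberTheory.EllipticCurves.ModularForms
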